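/-
Copyright: the b2b-balaban T⁴-continuum CRUX team, row NE7b leaf lineage `t4-ne7b-formalise-leaf-03` (gen 155; v1.2 = v1 + the note (ii) instance + chair R-1). Project licence.
-/
import Summits.QuantumFields.BalabanUV.T4Continuum.Spine.NE7b.SupBackgroundUniqueness
import Summits.QuantumFields.BalabanUV.T4Continuum.Spine.NE7b.SupLinearisedTorusCarrier

/-!
# THE LOCALISED BACKGROUND ON EVERY TORUS: (63)'s `σ` — the one carrying the response `Dσ(w)`, the covariance `C̃(w)` and their
# weighted ∕ far-support letters — restricted to `s`-periodic coarse fields IS a map of torus carriers `σt wt = σ(Ec wt) ∘ windowMap`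
# with the SAME letters, its periodicity from (74) `background_periodic` and its torus uniqueness from (74) `eq_of_sitewise`
# (`2λC_Γ(0) < 1`; no uniqueness clause of `σ` needed), and its response `Dσ` ∕ covariance `C̃` as torus operators — ONE application
# of SBT §2∕§3 and SLT §2 (row NE7b, node U5c; the OWNER's notes (i)+(ii) on W-ne7bp1-g115-11; (63), (74), SBT, SLT, PTC BY NAME; [folklore])

Cell `pub-balaban`, sub-cell `t4`, spine estimate NE7b (`T4WeightBudget.RelWeightBound`; the cell's OWN estimate — NOT PRINTED in
[Bałaban 1983–89], NOT PROVED).  Crux-route work under `Spine/NE7b/` by a row leaf (`t4-ne7b-formalise-leaf-03` gen 155) under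
FREEZE (0)'s crux-prover clause, on the row OWNER's word (`t4-ne7b-p1` g115, W-ne7bp1-g115-11 GO + note (i): «take `σ` from (63)
`exists_background_covariance_localised` (NOT (60) v1) so the torus object carries the weighted ∕ far-support letters too — its
periodicity is (74) `background_periodic` …, and torus uniqueness is (74) `eq_of_sitewise` read through your `Ec`∕`Rf`»); NOTHING of
Bałaban's is named as a Lean object, valued or asserted; no `T4Continuum/Support` leaf typed; no `def`, no notation; zero `sorry`.
Imports (BY NAME): the OWNER's (74) `…SupBackgroundUniqueness` (`background_periodic`, `eq_of_sitewise`, `abs_sub_le_of_deriv`; through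
it (63) `…SupBackgroundLocalisation.exists_background_covariance_localised`) and this lineage's SLT `…SupLinearisedTorusCarrier`
(`response_torus_of_letters`, `covariance_torus_of_letters`; through it SBT `background_torus_of_letters`, `background_torus_lipschitz`,
`torus_unique_of_sitewise_letter` and PTC's carrier maps).

WHAT IS PROVED ([folklore]): `smallness_of_localised_letters` (the smallness letter `2λ·A_G K_d(δ_u∕4)(1 + C_∞) < 1` of (73)∕(74)
FOLLOWS from (60)∕(63)'s binders `C_H + C_Γ(1 + C_H) ≤ N`, `2λ ≤ c < N⁻¹` — chair leaf-04 g164's R-1) and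
**`exists_background_torus_localised`** (`d ≥ 3`; (63)'s binders VERBATIM, nothing else; every coarse period `s ≥ 1`): (63)'s
`Q′ ∕ A ∕ P ∕ N′ ∕ σ ∕ C̃` with EVERY displayed action and letter of `exists_background_covariance_localised` RE-EXPORTED for the same
witnesses (closed-ball letter, Lipschitz, the interior package — response `D` with `Q′D = 1`, fibre equation, weighted letters;
covariance `C̃(w)` with its five letters and weighted letter; modulus), the four PTC carrier maps with actions and laws, and the torus
background `σt wt = Rf (σ (Ec wt))`: `σt 0 = 0`; on `‖wt‖ ≤ (N⁻¹ − c)·r`: `‖σt wt‖ ≤ r`, `Ef (σt wt) = σ (Ec wt)`, `Q′(Ef (σt wt)) =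
Ec wt`, `Rc (Q′(Ef (σt wt))) = wt`, the sitewise equation; `LipschitzOnWith (N⁻¹ − c)⁻¹ σt`; TORUS UNIQUENESS in (74)'s shape (a torus field
whose periodisation solves the sitewise equation with block means `Ec wt` IS `σt wt`); and, on the open torus ball (the OWNER's
note (ii), via SLT), THE RESPONSE AND THE COVARIANCE AS TORUS OPERATORS: `∃ D`, `HasFDerivAt σ D (Ec wt)`, `‖D‖ ≤ (N⁻¹ − c)⁻¹`,
`Ef (Dt vt) = D (Ec vt)`, `‖Dt‖ ≤ ‖D‖`, torus block means `vt` for `Dt := Rf ∘ D ∘ Ec`; `Ef (Ct gt) = C̃(Ec wt)(Ef gt)`, `‖Ct‖ ≤ ‖C̃(Ec wt)‖`,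
`Q′(Ef (Ct gt)) = 0` for `Ct := Rf ∘ C̃(Ec wt) ∘ Ef`.  §2 toy.

HONEST (what this is NOT).  Carrier bookkeeping: the analysis is (63)'s ∕ (74)'s, constants theirs (existential ∕ useless by value at
small sides); the weighted ∕ far-support letters stay `ℓ^∞` statements (they hold verbatim for the periodisations); cubic periods; scalar skeleton, not the covariant operators ((A3), NC-NE7b-α UNRULED); nothing of
Bałaban's.  BY-NAME EFFECT ON THE WALL: NONE.  NE7b NOT PRINTED ∕ NOT PROVED; spine PROVED 0∕9; rung (B)+1 on a FINITE torus — NOT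
infinite volume, NOT the mass gap, NOT Clay.  HONEST DEPENDENCY: continuum YM on T⁴ ⇐ BetaPertH ∧ nine spine estimates (0∕9
proved); BetaPertH ⇐ (D1) ∧ (D4) ∧ CAP+tail; G-an2-4 gates asym, D1 and NE2∕3∕4.
-/

set_option autoImplicit false

noncomputable section

namespace Summit.QuantumFields.BalabanUV.T4Continuum.NE7b.SupBackgroundTorusLocalised

open Set Metric
open scoped ENNReal NNReal
open Literature.MathematicalPhysics.QuantumFieldTheory.Balaban1983to89
open B4Sect5Proof (latticeConst latticeConst_nonneg)
open B6QGQLower276 (X blk B side AX)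
open B6QGQDecay237 (deltaU)
open B5Hk103ScalarZd (nbhd deltaH deltaH_pos)
open Summit.QuantumFields.BalabanUV.Beta.D1BFx.BlockColumnSupNorm (cHs cHs_nonneg)
open Summit.QuantumFields.BalabanUV.Beta.D1BFx.PointColumnSplit (cKL cG0 cSplit)
open Summit.QuantumFields.BalabanUV.Beta.D1BFx.PointColumnDecay (cFar)
open Beta (Site siteOf windowMap)
open SupBackgroundLocalisation (exists_background_covariance_localised)
open SupBackgroundUniqueness (background_periodic eq_of_sitewise abs_sub_le_of_deriv)
open PeriodicSupTorusCarrier (exists_clm_periodise exists_clm_restrict norm_periodise restrict_periodise periodise_periodic)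
open SupBackgroundTorusCarrier (background_torus_of_letters background_torus_lipschitz torus_unique_of_sitewise_letter)
open SupLinearisedTorusCarrier (response_torus_of_letters covariance_torus_of_letters)

variable {d : ℕ}

/-! ## §1. The smallness letter; the localised background on the torus carriers -/

/-- **THE SMALLNESS LETTER IS IMPLIED BY (60)∕(63)'s BINDERS** (chair leaf-04 g164's located R-1): `C_H + C_Γ(0)(1 + C_H) ≤ N`,
`2λ ≤ c`, `c < N⁻¹` give `2λ·C_Γ(0)(1 + C_H) ≤ 2λ·N ≤ c·N < 1` (`C_H ≥ 0`) — so (73)∕(74)'s displayed `hsmall` is free whenever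
(60)∕(63)'s `N, c` are in scope. [folklore] -/
theorem smallness_of_localised_letters (d : ℕ) {a : ℝ} (ha : 0 < a) {lam c N : ℝ≥0}
    (hN : cHs d a * latticeConst d (deltaH d a)
        + ((cG0 d * cKL d (d - 2) + cSplit d a) * Real.exp (2 * deltaU d a)
            + cFar d a * Real.exp (4 * deltaU d a) / deltaU d a ^ 2) * latticeConst d (deltaU d a / 4)
          * (1 + cHs d a * latticeConst d (deltaH d a)) ≤ (N : ℝ))
    (hc : 2 * lam ≤ c) (hcN : c < N⁻¹) :
    2 * (lam : ℝ) * (((cG0 d * cKL d (d - 2) + cSplit d a) * Real.exp (2 * deltaU d a)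
        + cFar d a * Real.exp (4 * deltaU d a) / deltaU d a ^ 2) * latticeConst d (deltaU d a / 4)
          * (1 + cHs d a * latticeConst d (deltaH d a))) < 1 := by
  set X := ((cG0 d * cKL d (d - 2) + cSplit d a) * Real.exp (2 * deltaU d a)
        + cFar d a * Real.exp (4 * deltaU d a) / deltaU d a ^ 2) * latticeConst d (deltaU d a / 4)
          * (1 + cHs d a * latticeConst d (deltaH d a))
  have hCH : 0 ≤ cHs d a * latticeConst d (deltaH d a) :=
    mul_nonneg (cHs_nonneg d ha) (latticeConst_nonneg d (deltaH_pos d ha).le)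
  have hXN : X ≤ (N : ℝ) := by linarith
  have hc' : 2 * (lam : ℝ) ≤ (c : ℝ) := by exact_mod_cast hc
  have hcN' : (c : ℝ) < ((N : ℝ))⁻¹ := by
    have h := NNReal.coe_lt_coe.2 hcN
    rwa [NNReal.coe_inv] at h
  have hNpos : 0 < (N : ℝ) := inv_pos.1 (lt_of_le_of_lt c.coe_nonneg hcN')
  have hcN1 : (c : ℝ) * N < 1 := by
    have h := mul_lt_mul_of_pos_right hcN' hNpos
    rwa [inv_mul_cancel₀ hNpos.ne'] at h
  calc 2 * (lam : ℝ) * X ≤ 2 * (lam : ℝ) * N := mul_le_mul_of_nonneg_left hXN (by positivity)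
    _ ≤ (c : ℝ) * N := mul_le_mul_of_nonneg_right hc' hNpos.le
    _ < 1 := hcN1

/-- **THE LOCALISED BACKGROUND ON EVERY TORUS** (`d ≥ 3`; (63)'s hypotheses verbatim, the smallness letter derived; every coarse
period `s ≥ 1`): (63) `exists_background_covariance_localised` RE-EXPORTED for the same witnesses, the PTC carrier maps, and the torus
background `σt wt = Rf (σ (Ec wt))` with the closed-ball ∕ block-mean ∕ sitewise ∕ Lipschitz letters on the torus ball and torus
uniqueness — periodicity by (74) `background_periodic`, uniqueness by (74) `eq_of_sitewise`, transfer by SBT §2∕§3. [folklore] -/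
theorem exists_background_torus_localised (hd : 3 ≤ d) (n : ℕ) {a : ℝ} (ha : 0 < a)
    {u u' : ℝ → ℝ} (hu : ∀ t, HasDerivAt u (u' t) t) (hu0 : u 0 = 0) {lam c N : ℝ≥0} (hlam : ∀ t, |u' t| ≤ lam)
    {L : ℝ} (hL0 : 0 ≤ L) (hL : ∀ s t, |u' s - u' t| ≤ L * |s - t|)
    (hN : cHs d a * latticeConst d (deltaH d a)
        + ((cG0 d * cKL d (d - 2) + cSplit d a) * Real.exp (2 * deltaU d a)
            + cFar d a * Real.exp (4 * deltaU d a) / deltaU d a ^ 2) * latticeConst d (deltaU d a / 4)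
          * (1 + cHs d a * latticeConst d (deltaH d a)) ≤ (N : ℝ))
    (hc : 2 * lam ≤ c) (hcN : c < N⁻¹) {r : ℝ} (hr : 0 ≤ r) (s : ℕ) [NeZero s] :
    ∃ (Dop Aop Pop : lp (fun _ : X d => ℝ) ∞ →L[ℝ] lp (fun _ : X d => ℝ) ∞)
      (N' : lp (fun _ : X d => ℝ) ∞ → (lp (fun _ : X d => ℝ) ∞ →L[ℝ] lp (fun _ : X d => ℝ) ∞))
      (σ : lp (fun _ : X d => ℝ) ∞ → lp (fun _ : X d => ℝ) ∞)
      (Cf : lp (fun _ : X d => ℝ) ∞ → (lp (fun _ : X d => ℝ) ∞ →L[ℝ] lp (fun _ : X d => ℝ) ∞))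
      (Ef : (Site d ((n + 1) * s) → ℝ) →L[ℝ] lp (fun _ : X d => ℝ) ∞)
      (Rf : lp (fun _ : X d => ℝ) ∞ →L[ℝ] (Site d ((n + 1) * s) → ℝ))
      (Ec : (Site d s → ℝ) →L[ℝ] lp (fun _ : X d => ℝ) ∞)
      (Rc : lp (fun _ : X d => ℝ) ∞ →L[ℝ] (Site d s → ℝ))
      (σt : (Site d s → ℝ) → (Site d ((n + 1) * s) → ℝ)),
      (∀ (f : lp (fun _ : X d => ℝ) ∞) (y : X d), Dop f y = (((n : ℝ) + 1) ^ d)⁻¹ * ∑ p ∈ B n y, f p) ∧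
      (∀ (f : lp (fun _ : X d => ℝ) ∞) (p : X d), Aop f p = ∑ r ∈ nbhd n p, AX n a p r * f r) ∧
      (∀ (f : lp (fun _ : X d => ℝ) ∞) (p : X d), Pop f p = f p - (((n : ℝ) + 1) ^ d)⁻¹ * ∑ p' ∈ B n (blk n p), f p') ∧
      (∀ (φ h : lp (fun _ : X d => ℝ) ∞) (p : X d), N' φ h p = u' (φ p) * h p) ∧
      σ 0 = 0 ∧
      (∀ w ∈ closedBall (0 : lp (fun _ : X d => ℝ) ∞) (((N : ℝ)⁻¹ - c) * r),
        σ w ∈ closedBall 0 r ∧ Dop (σ w) = w ∧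
          ∀ p : X d, Aop (σ w) p + u (σ w p)
            = (((n : ℝ) + 1) ^ d)⁻¹ * ∑ p' ∈ B n (blk n p), (Aop (σ w) p' + u (σ w p'))) ∧
      LipschitzOnWith (N⁻¹ - c)⁻¹ σ (closedBall (0 : lp (fun _ : X d => ℝ) ∞) (((N : ℝ)⁻¹ - c) * r)) ∧
      (∀ w ∈ ball (0 : lp (fun _ : X d => ℝ) ∞) (((N : ℝ)⁻¹ - c) * r),
        (∃ D : lp (fun _ : X d => ℝ) ∞ →L[ℝ] lp (fun _ : X d => ℝ) ∞,
          HasFDerivAt σ D w ∧ ‖D‖ ≤ ((N : ℝ)⁻¹ - c)⁻¹ ∧ Dop.comp D = ContinuousLinearMap.id ℝ (lp (fun _ : X d => ℝ) ∞) ∧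
          (∀ v : lp (fun _ : X d => ℝ) ∞, Pop (Aop (D v) + N' (σ w) (D v)) = 0) ∧
          (∀ μ : ℝ, 0 ≤ μ → μ < deltaH d a → μ < deltaU d a / 4 →
            2 * (lam : ℝ) * (((cG0 d * cKL d (d - 2) + cSplit d a) * Real.exp (2 * deltaU d a)
                + cFar d a * Real.exp (4 * deltaU d a) / deltaU d a ^ 2) * latticeConst d (deltaU d a / 4 - μ)
                  * (1 + cHs d a * latticeConst d (deltaH d a - μ))) < 1 →
            ∀ ρ : X d → ℝ, (∀ x y, ρ x - ρ y ≤ dist x y) → (∃ M : ℝ, ∀ y, |ρ y| ≤ M) →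
            ∀ (v : lp (fun _ : X d => ℝ) ∞) (Rv : ℝ), (∀ y, Real.exp (μ * ρ y) * |v y| ≤ Rv) →
            ∀ p : X d, Real.exp (μ * ρ (blk n p)) * |D v p|
              ≤ (1 - 2 * (lam : ℝ) * (((cG0 d * cKL d (d - 2) + cSplit d a) * Real.exp (2 * deltaU d a)
                    + cFar d a * Real.exp (4 * deltaU d a) / deltaU d a ^ 2) * latticeConst d (deltaU d a / 4 - μ)
                      * (1 + cHs d a * latticeConst d (deltaH d a - μ))))⁻¹
                * (cHs d a * latticeConst d (deltaH d a - μ) * Rv))) ∧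
        (∀ g : lp (fun _ : X d => ℝ) ∞, Dop (Cf w g) = 0) ∧
        (∀ g : lp (fun _ : X d => ℝ) ∞, Pop (Aop (Cf w g) + N' (σ w) (Cf w g)) = Pop g) ∧
        (∀ g h : lp (fun _ : X d => ℝ) ∞, Dop h = 0 → Pop (Aop h + N' (σ w) h) = Pop g → h = Cf w g) ∧
        (∀ g : lp (fun _ : X d => ℝ) ∞, ‖Cf w g‖ ≤ 2 * ((N : ℝ)⁻¹ - c)⁻¹ * ‖g‖) ∧
        (∀ g : lp (fun _ : X d => ℝ) ∞, Dop g = 0 → ‖Cf w g‖ ≤ ((N : ℝ)⁻¹ - c)⁻¹ * ‖g‖) ∧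
        (∀ μ : ℝ, 0 ≤ μ → μ < deltaH d a → μ < deltaU d a / 4 →
          2 * (lam : ℝ) * (((cG0 d * cKL d (d - 2) + cSplit d a) * Real.exp (2 * deltaU d a)
              + cFar d a * Real.exp (4 * deltaU d a) / deltaU d a ^ 2) * latticeConst d (deltaU d a / 4 - μ)
                * (1 + cHs d a * latticeConst d (deltaH d a - μ))) < 1 →
          ∀ ρ : X d → ℝ, (∀ x y, ρ x - ρ y ≤ dist x y) → (∃ M : ℝ, ∀ y, |ρ y| ≤ M) →
          ∀ (f : lp (fun _ : X d => ℝ) ∞) (Rf : ℝ), (∀ q, Real.exp (μ * ρ (blk n q)) * |f q| ≤ Rf) →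
          ∀ p : X d, Real.exp (μ * ρ (blk n p)) * |Cf w f p|
            ≤ (1 - 2 * (lam : ℝ) * (((cG0 d * cKL d (d - 2) + cSplit d a) * Real.exp (2 * deltaU d a)
                  + cFar d a * Real.exp (4 * deltaU d a) / deltaU d a ^ 2) * latticeConst d (deltaU d a / 4 - μ)
                    * (1 + cHs d a * latticeConst d (deltaH d a - μ))))⁻¹
              * (((cG0 d * cKL d (d - 2) + cSplit d a) * Real.exp (2 * deltaU d a)
                  + cFar d a * Real.exp (4 * deltaU d a) / deltaU d a ^ 2) * latticeConst d (deltaU d a / 4 - μ)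
                    * (1 + cHs d a * latticeConst d (deltaH d a - μ)) * (2 * Rf)))) ∧
      (∀ w ∈ ball (0 : lp (fun _ : X d => ℝ) ∞) (((N : ℝ)⁻¹ - c) * r),
        ∀ w' ∈ ball (0 : lp (fun _ : X d => ℝ) ∞) (((N : ℝ)⁻¹ - c) * r), ∀ g : lp (fun _ : X d => ℝ) ∞,
          ‖Cf w g - Cf w' g‖ ≤ ((N : ℝ)⁻¹ - c)⁻¹ ^ 3 * (4 * L) * ‖w - w'‖ * ‖g‖) ∧
      -- the carrier maps (PTC), actions and laws
      (∀ (g : Site d ((n + 1) * s) → ℝ) (q : X d), Ef g q = g (siteOf d ((n + 1) * s) q)) ∧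
      (∀ (h : lp (fun _ : X d => ℝ) ∞) (x : Site d ((n + 1) * s)), Rf h x = h (windowMap d ((n + 1) * s) x)) ∧
      (∀ (g : Site d s → ℝ) (q : X d), Ec g q = g (siteOf d s q)) ∧
      (∀ (h : lp (fun _ : X d => ℝ) ∞) (x : Site d s), Rc h x = h (windowMap d s x)) ∧
      (∀ g, ‖Ef g‖ = ‖g‖) ∧ (∀ g, Rf (Ef g) = g) ∧ (∀ g, ‖Ec g‖ = ‖g‖) ∧ (∀ g, Rc (Ec g) = g) ∧
      -- the torus background of the LOCALISED σ
      (∀ wt, σt wt = Rf (σ (Ec wt))) ∧ σt 0 = 0 ∧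
      (∀ wt ∈ closedBall (0 : Site d s → ℝ) (((N : ℝ)⁻¹ - c) * r),
        σt wt ∈ closedBall 0 r ∧ Ef (σt wt) = σ (Ec wt) ∧ Dop (Ef (σt wt)) = Ec wt ∧ Rc (Dop (Ef (σt wt))) = wt ∧
          ∀ p : X d, Aop (Ef (σt wt)) p + u (Ef (σt wt) p)
            = (((n : ℝ) + 1) ^ d)⁻¹ * ∑ p' ∈ B n (blk n p), (Aop (Ef (σt wt)) p' + u (Ef (σt wt) p'))) ∧
      LipschitzOnWith (N⁻¹ - c)⁻¹ σt (closedBall (0 : Site d s → ℝ) (((N : ℝ)⁻¹ - c) * r)) ∧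
      (∀ wt ∈ closedBall (0 : Site d s → ℝ) (((N : ℝ)⁻¹ - c) * r), ∀ φt : Site d ((n + 1) * s) → ℝ,
        Dop (Ef φt) = Ec wt →
        (∀ p : X d, Aop (Ef φt) p + u (Ef φt p)
            = (((n : ℝ) + 1) ^ d)⁻¹ * ∑ p' ∈ B n (blk n p), (Aop (Ef φt) p' + u (Ef φt p'))) →
          σt wt = φt) ∧
      -- the response and the covariance at a torus background, as operators of torus carriers (SLT; the OWNER's note (ii))
      (∀ wt ∈ ball (0 : Site d s → ℝ) (((N : ℝ)⁻¹ - c) * r),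
        (∃ D : lp (fun _ : X d => ℝ) ∞ →L[ℝ] lp (fun _ : X d => ℝ) ∞,
          HasFDerivAt σ D (Ec wt) ∧ ‖D‖ ≤ ((N : ℝ)⁻¹ - c)⁻¹ ∧
            (∀ vt, Ef (((Rf.comp D).comp Ec) vt) = D (Ec vt)) ∧ ‖(Rf.comp D).comp Ec‖ ≤ ‖D‖ ∧
            ∀ vt, Rc (Dop (Ef (((Rf.comp D).comp Ec) vt))) = vt) ∧
        (∀ gt, Ef (((Rf.comp (Cf (Ec wt))).comp Ef) gt) = Cf (Ec wt) (Ef gt)) ∧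
        ‖(Rf.comp (Cf (Ec wt))).comp Ef‖ ≤ ‖Cf (Ec wt)‖ ∧
        ∀ gt, Dop (Ef (((Rf.comp (Cf (Ec wt))).comp Ef) gt)) = 0) := by
  have hsmall := smallness_of_localised_letters d ha hN hc hcN
  obtain ⟨Dop, Aop, Pop, N', σ, Cf, hD, hA, hP, hN'app, hσ0, hσ, hlip, hint, hmod⟩ :=
    exists_background_covariance_localised hd n ha hu hu0 hlam hL0 hL hN hc hcN hr
  obtain ⟨Ef, hEf⟩ := exists_clm_periodise (d := d) ((n + 1) * s)
  obtain ⟨Rf, hRf, -⟩ := exists_clm_restrict (d := d) ((n + 1) * s)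
  obtain ⟨Ec, hEc⟩ := exists_clm_periodise (d := d) s
  obtain ⟨Rc, hRc, -⟩ := exists_clm_restrict (d := d) s
  -- (74): periodicity of the background of a periodic coarse field, from the sitewise letter alone (`2λC_Γ(0) < 1`)
  have hσ' : ∀ w ∈ closedBall (0 : lp (fun _ : X d => ℝ) ∞) (((N : ℝ)⁻¹ - c) * r), Dop (σ w) = w ∧
      ∀ p : X d, Aop (σ w) p + u (σ w p)
        = (((n : ℝ) + 1) ^ d)⁻¹ * ∑ p' ∈ B n (blk n p), (Aop (σ w) p' + u (σ w p')) :=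
    fun w hw => ⟨(hσ w hw).2.1, (hσ w hw).2.2⟩
  have hlam' : ∀ t, |u' t| ≤ (lam : ℝ) := hlam
  have hperσ : ∀ w ∈ closedBall (0 : lp (fun _ : X d => ℝ) ∞) (((N : ℝ)⁻¹ - c) * r),
      (∀ y t : X d, w (y + (s : ℤ) • t) = w y) → ∀ q t : X d, σ w (q + side n • ((s : ℤ) • t)) = σ w q :=
    fun w hw hper q t => background_periodic hd n ha Dop Aop Pop hD hA hP hu hlam' hsmall hσ' s hw hper q t
  -- (74): two `ℓ^∞` solutions with the same block means agree
  have hES : ∀ φ ψ : lp (fun _ : X d => ℝ) ∞, Dop φ = Dop ψ →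
      (∀ p : X d, Aop φ p + u (φ p) = (((n : ℝ) + 1) ^ d)⁻¹ * ∑ p' ∈ B n (blk n p), (Aop φ p' + u (φ p'))) →
      (∀ p : X d, Aop ψ p + u (ψ p) = (((n : ℝ) + 1) ^ d)⁻¹ * ∑ p' ∈ B n (blk n p), (Aop ψ p' + u (ψ p'))) → φ = ψ :=
    fun φ ψ hDeq hφ hψ => eq_of_sitewise hd n ha Dop Aop Pop hD hA hP lam.coe_nonneg (abs_sub_le_of_deriv hu hlam') hsmall
      φ ψ hDeq hφ hψ
  have hσt : ∀ wt : Site d s → ℝ, (fun wt => Rf (σ (Ec wt))) wt = Rf (σ (Ec wt)) := fun _ => rfl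
  refine ⟨Dop, Aop, Pop, N', σ, Cf, Ef, Rf, Ec, Rc, fun wt => Rf (σ (Ec wt)), hD, hA, hP, hN'app, hσ0, hσ, hlip, hint, hmod,
    hEf, hRf, hEc, hRc, norm_periodise hEf, restrict_periodise hEf hRf, norm_periodise hEc, restrict_periodise hEc hRc, hσt,
    by beta_reduce; rw [map_zero, hσ0, map_zero],
    fun wt hwt => background_torus_of_letters hσ hperσ hEf hRf hEc hRc hσt wt hwt,
    background_torus_lipschitz hlip hperσ hEf hRf hEc hσt,
    fun wt hwt φt hDφ heq => torus_unique_of_sitewise_letter hσ hES hEf hRf hEc hσt hwt φt hDφ heq,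
    fun wt hwt => ?_⟩
  -- the open torus ball maps into (63)'s open ball; the background there is periodic, hence so is `g := u′ ∘ σ(Ec wt)`
  have hball : Ec wt ∈ ball (0 : lp (fun _ : X d => ℝ) ∞) (((N : ℝ)⁻¹ - c) * r) := by
    rw [mem_ball_zero_iff] at hwt ⊢
    rwa [norm_periodise hEc]
  have hgper : ∀ q t : X d, u' (σ (Ec wt) (q + side n • ((s : ℤ) • t))) = u' (σ (Ec wt) q) := fun q t => by
    rw [hperσ (Ec wt) (ball_subset_closedBall hball) (periodise_periodic hEc wt) q t]
  obtain ⟨⟨D, hDσ, hDn, hDD, hfib, -⟩, hC1, hC2, -, -, -, -⟩ := hint (Ec wt) hball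
  have hD1 : ∀ v, Dop (D v) = v := fun v => by
    have e := congrArg (fun T : lp (fun _ : X d => ℝ) ∞ →L[ℝ] lp (fun _ : X d => ℝ) ∞ => T v) hDD
    simpa using e
  obtain ⟨r1, r2, r3⟩ := response_torus_of_letters hd n ha Dop Aop Pop (N' (σ (Ec wt))) hD hA hP (hN'app (σ (Ec wt)))
    (fun p => hlam' _) hsmall s hgper D hD1 hfib hEf hRf hEc hRc
  obtain ⟨c1, c2, c3⟩ := covariance_torus_of_letters hd n ha Dop Aop Pop (N' (σ (Ec wt))) hD hA hP (hN'app (σ (Ec wt)))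
    (fun p => hlam' _) hsmall s hgper (Cf (Ec wt)) hC1 hC2 hEf hRf
  exact ⟨⟨D, hDσ, hDn, r1, r2, r3⟩, c1, c2, c3⟩

/-! ## §2. Toy -/

/-- Toy: the smallness letter at `λ = 0` is trivial (`0 < 1`). [folklore] -/
example (A : ℝ) : 2 * (0 : ℝ) * A < 1 := by rw [mul_zero, zero_mul]; exact one_pos

end Summit.QuantumFields.BalabanUV.T4Continuum.NE7b.SupBackgroundTorusLocalised

end
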